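import Summits.FinalStateConjecture.FinalStateConjecture.Theorems.EIHFluxBalanceInertialRecessionFlatChart
import Summits.FinalStateConjecture.FinalStateConjecture.Theorems.EIHFluxBalanceInertialRecessionSchwarzschildFrame
import Summits.FinalStateConjecture.FinalStateConjecture.Theorems.EIHFluxBalanceInertialRecessionBoostCalculus

/-!
# Route EIHFluxBalance — `InertialRecession`: the flat chart for Schwarzschild holes from velocity-level data

Helper file for the crux `stmt-FinalStateConjecture-10166`
(`Summit.FinalStateConjecture.FinalStateConjecture.Theses.EIHFluxBalance.InertialRecession`).

End-to-end form of the radiation-zone clause for NON-ROTATING holes (`aᵢ = 0`): the flat chart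
`Φ|U₀` on a hole-following far domain converges to `η` in `Cᵏ` assuming, beyond the crux
hypothesis' `Cᵏ` deviation decay, only VELOCITY-LEVEL control of the painted motions — the painted
4-velocities `Λᵢ(t)e₀` are future-pointing with lab velocities `vᵢ(t)` (`(Λᵢ(t)e₀)~ = (Λᵢ(t)e₀)⁰ vᵢ(t)`)
of speed `≤ κ₀ < 1`, smooth, with `k` derivatives bounded from some time on, and likewise for the
centres `ξᵢ` (`tendsto_deviationCk_flat_of_ansatz_schwarzschild`). Nothing is assumed about the
frame paths `Λᵢ` themselves (they may spin freely in the stabiliser of the Schwarzschild form):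
by `boostedKerrBilin_eq_boost_of_velocity` the reference field is unchanged when `Λᵢ(t)` is
replaced by the pure boost `boost(vᵢ(t))` (file `…SchwarzschildFrame`), whose inverse
`boostCLM(−vᵢ(t))` is an operator path with bounded derivatives (file `…BoostCalculus`), so the
general estimate `tendsto_deviationCk_flat_of_ansatz'` (file `…FlatChart`) applies. This is the
interface a line's slaving statement (which controls `Λᵢe₀`, not `Λᵢ`) can meet directly.
-/

noncomputable section

open Literature.Geometry.Lorentzian Set Filter Function TopologicalSpace
open scoped ContDiff Topology Manifold ENNReal

namespace Summit.FinalStateConjecture.FinalStateConjecture.Theorems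

/-- Boost elements with equal velocities are equal (the proof argument is irrelevant). [folklore] -/
theorem lorentzBoost_congr {v w : E3} (h : v = w) (hv : ‖v‖ < 1) (hw : ‖w‖ < 1) :
    Lorentz.boost v hv = Lorentz.boost w hw := by
  subst h
  rfl

/-- **The painted Schwarzschild summand in terms of any lab velocity of the painted 4-velocity**:
if `Λe₀` is future-pointing with `(Λe₀)~ = (Λe₀)⁰ v`, then
`boostedKerrBilin Λ c M 0 = boostedKerrBilin (boost v) c M 0` (frame normalisation
`boostedKerrBilin_eq_boost_boostVelocity` with `v(Λ) = v`). Kerr–Schild 1965, §2. [cite: KerrSchild1965, §2] -/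
theorem boostedKerrBilin_eq_boost_of_velocity (Λ : lorentzGroup) {v : E3}
    (hfut : 0 < ((Λ : E4 ≃L[ℝ] E4) (E4.basisVector 0)) 0)
    (hv : E4.spatial ((Λ : E4 ≃L[ℝ] E4) (E4.basisVector 0)) =
      (((Λ : E4 ≃L[ℝ] E4) (E4.basisVector 0)) 0) • v) (hv1 : ‖v‖ < 1)
    (c : E4) (M : ℝ) (x : E4) :
    boostedKerrBilin Λ c M 0 x = boostedKerrBilin (Lorentz.boost v hv1) c M 0 x := by
  have hvel : (((Λ : E4 ≃L[ℝ] E4) (E4.basisVector 0)) 0)⁻¹ •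
      E4.spatial ((Λ : E4 ≃L[ℝ] E4) (E4.basisVector 0)) = v := by
    rw [hv, smul_smul, inv_mul_cancel₀ hfut.ne', one_smul]
  rw [boostedKerrBilin_eq_boost_boostVelocity Λ hfut c M x,
    lorentzBoost_congr hvel (norm_boostVelocity_lt_one Λ hfut) hv1]

-- operator-norm instance paths on form-valued multilinear maps are slow to unify
set_option synthInstance.maxHeartbeats 200000 in
/-- **Flat chart on a hole-following domain, Schwarzschild holes, velocity-level hypotheses.** Let
`Φ : U → M` be smooth with `deviationCk B Φ k t → 0` for the crux's modulated background `B` with all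
spins `aᵢ = 0`. Assume the painted 4-velocities are future-pointing with smooth lab velocities `vᵢ`
of speed `≤ κ₀ < 1` and `‖vᵢ⁽ʲ⁾(t)‖, ‖ξᵢ⁽ʲ⁾(t)‖ ≤ Γ` for `1 ≤ j ≤ k`, `t ≥ T₀`, and let `U₀ ≤ U` keep lab
distance `> R′(t) → ∞` from every centre. Then `deviationCk (Minkowski.backgroundOn U₀) (Φ|U₀) k t → 0`.
Proof: replace each `Λᵢ(t)` by `boost(vᵢ(t))` (same reference field, `boostedKerrBilin_eq_boost_of_velocity`),
whose inverse `boostCLM(−vᵢ(t))` has `k` derivatives bounded by `Γ'(k, κ₀, Γ)`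
(`exists_bound_iteratedDeriv_boostCLM_neg_comp`), and apply `tendsto_deviationCk_flat_of_ansatz'`.
DHRT arXiv:2104.08222, §1; Kerr–Schild 1965, §3. [folklore] -/
theorem tendsto_deviationCk_flat_of_ansatz_schwarzschild' (𝓢 : Spacetime 4) {N : ℕ} (M : Fin N → ℝ)
    (Λ : Fin N → ℝ → lorentzGroup) (ξ v : Fin N → ℝ → E3) (U : Opens E4) (Φ : U → 𝓢.carrier)
    (hΦ : ContMDiff 𝓘(ℝ, E4) (𝓡 4) ∞ Φ) {k : ℕ}
    (hdev : Tendsto (fun t ↦ 𝓢.deviationCk ⟨U, fun x ↦ Minkowski.bilin +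
      ∑ i, (boostedKerrBilin (Λ i (x 0)) (E4.ofTimeSpace (x 0) (ξ i (x 0))) (M i) 0 x -
        Minkowski.bilin), fun x ↦ x 0, E4.spatialNorm⟩ Φ k t) atTop (𝓝 0))
    (hfut : ∀ i t, 0 < (((Λ i t : E4 ≃L[ℝ] E4) (E4.basisVector 0)) 0))
    (hvΛ : ∀ i t, E4.spatial ((Λ i t : E4 ≃L[ℝ] E4) (E4.basisVector 0)) =
      (((Λ i t : E4 ≃L[ℝ] E4) (E4.basisVector 0)) 0) • v i t)
    {κ₀ : ℝ} (hκ₀ : κ₀ < 1) (hvs : ∀ i t, ‖v i t‖ ≤ κ₀)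
    (hv : ∀ i, ContDiff ℝ ∞ (v i)) (hξ : ∀ i, ContDiff ℝ ∞ (ξ i)) {Γ T₀ : ℝ}
    (hvb : ∀ i t, T₀ ≤ t → ∀ j, 1 ≤ j → j ≤ k → ‖iteratedDeriv j (v i) t‖ ≤ Γ)
    (hξb : ∀ i t, T₀ ≤ t → ∀ j, 1 ≤ j → j ≤ k → ‖iteratedDeriv j (ξ i) t‖ ≤ Γ)
    {R' : ℝ → ℝ} (hR : Tendsto R' atTop atTop) {U₀ : Opens E4} (hU₀ : U₀ ≤ U)
    (hfar : ∀ z ∈ U₀, ∀ i, R' (z 0) < ‖E4.spatial z - ξ i (z 0)‖) :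
    Tendsto (fun t ↦ 𝓢.deviationCk (Minkowski.backgroundOn U₀) (Φ ∘ Opens.inclusion hU₀) k t)
      atTop (𝓝 0) := by
  have hv1 : ∀ i t, ‖v i t‖ < 1 := fun i t ↦ (hvs i t).trans_lt hκ₀
  -- the normalised frames
  set Λ' : Fin N → ℝ → lorentzGroup := fun i t ↦ Lorentz.boost (v i t) (hv1 i t) with hΛ'
  -- the reference fields agree
  have hsum : (fun x : E4 ↦ Minkowski.bilin +
      ∑ i, (boostedKerrBilin (Λ i (x 0)) (E4.ofTimeSpace (x 0) (ξ i (x 0))) (M i) 0 x -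
        Minkowski.bilin)) = fun x ↦ Minkowski.bilin +
      ∑ i, (boostedKerrBilin (Λ' i (x 0)) (E4.ofTimeSpace (x 0) (ξ i (x 0))) (M i) 0 x -
        Minkowski.bilin) := by
    funext x
    congr 1
    refine Finset.sum_congr rfl fun i _ ↦ ?_
    rw [boostedKerrBilin_eq_boost_of_velocity (Λ i (x 0)) (hfut i (x 0)) (hvΛ i (x 0))
      (hv1 i (x 0))]
  have hdev' : Tendsto (fun t ↦ 𝓢.deviationCk ⟨U, fun x ↦ Minkowski.bilin +
      ∑ i, (boostedKerrBilin (Λ' i (x 0)) (E4.ofTimeSpace (x 0) (ξ i (x 0))) (M i) 0 x -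
        Minkowski.bilin), fun x ↦ x 0, E4.spatialNorm⟩ Φ k t) atTop (𝓝 0) :=
    hdev.congr fun t ↦ deviationCk_mk_congr 𝓢 U hsum _ _ Φ k t
  -- the inverse frames are the explicit operators `boostCLM (−vᵢ)`
  have hsymm : ∀ i, (fun s ↦ (((Λ' i s : E4 ≃L[ℝ] E4).symm : E4 →L[ℝ] E4))) =
      fun s ↦ Lorentz.boostCLM (-v i s) := fun i ↦ funext fun s ↦ coe_boost_symm' (hv1 i s)
  have hΛ'c : ∀ i, ContDiff ℝ ∞ (fun s ↦ (((Λ' i s : E4 ≃L[ℝ] E4).symm : E4 →L[ℝ] E4))) :=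
    fun i ↦ by
      rw [hsymm i]
      exact contDiff_boostCLM_neg_comp (hv i) (hv1 i)
  -- uniform derivative bounds for the inverse frames
  obtain ⟨Γ', hΓ'⟩ := exists_bound_iteratedDeriv_boostCLM_neg_comp k hκ₀ Γ
  set Γ₁ : ℝ := max (max Γ' Γ) 1 with hΓ₁
  have hΓ₁1 : 1 ≤ Γ₁ := le_max_right _ _
  have hΛ'b : ∀ i t, T₀ ≤ t → ∀ j ≤ k,
      ‖iteratedDeriv j (fun s ↦ (((Λ' i s : E4 ≃L[ℝ] E4).symm : E4 →L[ℝ] E4))) t‖ ≤ Γ₁ := by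
    intro i t ht j hj
    rw [hsymm i]
    exact (hΓ' (v i) t ((hv i).of_le (by exact_mod_cast le_top)) (hvs i)
      (fun j' hj1 hj' ↦ hvb i t ht j' hj1 hj') j hj).trans
      ((le_max_left _ _).trans (le_max_left _ _))
  have hξb' : ∀ i t, T₀ ≤ t → ∀ j, 1 ≤ j → j ≤ k → ‖iteratedDeriv j (ξ i) t‖ ≤ Γ₁ :=
    fun i t ht j hj1 hj ↦ (hξb i t ht j hj1 hj).trans ((le_max_right _ _).trans (le_max_left _ _))
  exact tendsto_deviationCk_flat_of_ansatz' 𝓢 M (fun _ ↦ 0) Λ' ξ U Φ hΦ hdev' hΛ'c hξ hΓ₁1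
    hΛ'b hξb' hR hU₀ hfar

-- operator-norm instance paths on form-valued multilinear maps are slow to unify
set_option synthInstance.maxHeartbeats 200000 in
/-- Registered sub-goal form (stub `tendsto_deviationCk_flat_of_ansatz_schwarzschild` of the crux
item) of `tendsto_deviationCk_flat_of_ansatz_schwarzschild'`. [folklore] -/
theorem tendsto_deviationCk_flat_of_ansatz_schwarzschild : open Literature.Geometry.Lorentzian in ∀ (𝓢 : Spacetime 4) {N : ℕ} (M : Fin N → ℝ) (Λ : Fin N → ℝ → lorentzGroup) (ξ v : Fin N → ℝ → E3) (U : Opens E4) (Φ : U → 𝓢.carrier), ContMDiff 𝓘(ℝ, E4) (𝓡 4) ((⊤ : ℕ∞) : WithTop ℕ∞) Φ → ∀ {k : ℕ}, Tendsto (fun t ↦ 𝓢.deviationCk ⟨U, fun x ↦ Minkowski.bilin + ∑ i, (boostedKerrBilin (Λ i (x 0)) (E4.ofTimeSpace (x 0) (ξ i (x 0))) (M i) 0 x - Minkowski.bilin), fun x ↦ x 0, E4.spatialNorm⟩ Φ k t) atTop (𝓝 0) → (∀ i t, 0 < (((Λ i t : E4 ≃L[ℝ] E4) (E4.basisVector 0))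 0)) → (∀ i t, E4.spatial ((Λ i t : E4 ≃L[ℝ] E4) (E4.basisVector 0)) = (((Λ i t : E4 ≃L[ℝ] E4) (E4.basisVector 0)) 0) • v i t) → ∀ {κ₀ : ℝ}, κ₀ < 1 → (∀ i t, ‖v i t‖ ≤ κ₀) → (∀ i, ContDiff ℝ ((⊤ : ℕ∞) : WithTop ℕ∞) (v i)) → (∀ i, ContDiff ℝ ((⊤ : ℕ∞) : WithTop ℕ∞) (ξ i)) → ∀ {Γ T₀ : ℝ}, (∀ i t, T₀ ≤ t → ∀ j, 1 ≤ j → j ≤ k → ‖iteratedDeriv j (v i) t‖ ≤ Γ) → (∀ i t, T₀ ≤ t → ∀ j, 1 ≤ j → j ≤ k → ‖iteratedDeriv j (ξ i) t‖ ≤ Γ) → ∀ {R' : ℝ → ℝ}, Tendsto R' atTop atTop → ∀ {U₀ : Opens E4} (hU₀ : U₀ ≤ U), (∀ z ∈ U₀, ∀ i, R' (z 0) < ‖E4.spatial z - ξ i (z 0)‖) → Tendsto (fun t ↦ 𝓢.deviationCk (Minkowski.backgroundOn U₀) (Φ ∘ Opens.inclusion hU₀) k t) atTop (𝓝 0) 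:=
  fun 𝓢 _ M Λ ξ v U Φ hΦ _ hdev hfut hvΛ _ hκ₀ hvs hv hξ _ _ hvb hξb _ hR _ hU₀ hfar ↦
    tendsto_deviationCk_flat_of_ansatz_schwarzschild' 𝓢 M Λ ξ v U Φ hΦ hdev hfut hvΛ hκ₀ hvs hv hξ
      hvb hξb hR hU₀ hfar

end Summit.FinalStateConjecture.FinalStateConjecture.Theorems

end
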